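import Summits.Ventures.CertifiedArithmetic.LowPrec.SRMonotone
import Summits.Ventures.CertifiedArithmetic.LowPrec.SRSpacing
import HarnessLib

/-!
# Stochastic rounding into a finite format, XVIII: the box certificate for saturation

HONEST FRAMING: certified error envelopes and provably optimal rounding/accumulation schemes for
low-precision formats under stated cost models; every table by two implementations; no hardware or
vendor claims.

Venture CertifiedArithmetic / lowprec, SR slice (gen5), sequel to file XVII (`SRMonotone`).

* `treeExpE2` — the joint law of the root value and TWO exit flags (predicates `e₁`, `e₂`); its
  marginals are the one-flag semantics and `treeExpE F (e₁ ∨ e₂)` factors through it, whence the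
  union bound `exitE_union : P(exit e₁ ∨ e₂) ≤ P(exit e₁) + P(exit e₂)`.
* `satProbT_eq_exitE` — saturation (file X) is the exit predicate `c < lo ∨ hi < c` for a format with
  hull `[lo, hi]`.
* **`satProbT_le_corners` (BOX CERTIFICATE)**: `Tlo ≤ T ≤ Thi` leafwise ⇒
  `P(sat, T) ≤ P(upper exit, Thi) + P(lower exit, Tlo)`; **`satProbT_le_upper_corner`**: for data in
  `[0, a]` coordinatewise (`0 ∈ F`, `lo ≤ 0`) the lower term vanishes, so `P(sat, T) ≤ P(upper exit at
  the corner (a, …, a))` — one number, exact and attained at the corner, computed once by the forward law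
  (file XIX `SRLaw`: kernel for FP4/FP6; `code/sr/gen5/exactlaw_{A,B}.py` + `certs/sr/gen5/` for FP8,
  e.g. every E4M3 sequential SR sum of 128 numbers in `[0, 1]` saturates with probability
  `≤ 6.51·10⁻¹⁰`, two implementations, byte-identical).
* Kernel instance (`decide +kernel`, plain branch enumeration, 2⁷ branches): E2M1, left comb of any
  8 summands in `[0, 1]`: `P(sat) ≤ 7/8`, attained at `(1, …, 1)`.
-/

namespace Summit.Ventures.CertifiedArithmetic.LowPrec.SR

open Literature.ComputerArithmetic.ConnollyHighamMary2021 Literature.ComputerArithmetic.FloatingPoint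
open Finset STree

variable {K : Type*} [Field K] [LinearOrder K] [IsStrictOrderedRing K]

/-! ### Two flags -/

/-- Joint semantics with two exit flags. -/
def treeExpE2 (F : Finset K) (e₁ e₂ : K → Bool) : STree K → (K → Bool → Bool → K) → K
  | .leaf x, φ => φ x false false
  | .node l r, φ => treeExpE2 F e₁ e₂ l (fun a fa ga => treeExpE2 F e₁ e₂ r (fun b fb gb =>
      step F (a + b) (fun v => φ v (fa || fb || e₁ (a + b)) (ga || gb || e₂ (a + b)))))

omit [IsStrictOrderedRing K] in
/-- `treeExpE2` respects pointwise equality of integrands. -/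
theorem treeExpE2_congr (F : Finset K) (e₁ e₂ : K → Bool) (T : STree K) {φ ψ : K → Bool → Bool → K}
    (h : ∀ v b b', φ v b b' = ψ v b b') : treeExpE2 F e₁ e₂ T φ = treeExpE2 F e₁ e₂ T ψ := by
  rw [show φ = ψ from funext fun v => funext fun b => funext fun b' => h v b b']

omit [IsStrictOrderedRing K] in
/-- Additivity. -/
theorem treeExpE2_add (F : Finset K) (e₁ e₂ : K → Bool) : ∀ (T : STree K) (φ ψ : K → Bool → Bool → K),
    treeExpE2 F e₁ e₂ T (fun v b b' => φ v b b' + ψ v b b')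
      = treeExpE2 F e₁ e₂ T φ + treeExpE2 F e₁ e₂ T ψ
  | .leaf x, φ, ψ => rfl
  | .node l r, φ, ψ => by
      simp only [treeExpE2]
      rw [← treeExpE2_add F e₁ e₂ l]
      refine treeExpE2_congr F e₁ e₂ l (fun a fa ga => ?_)
      rw [← treeExpE2_add F e₁ e₂ r]
      exact treeExpE2_congr F e₁ e₂ r (fun b fb gb => step_add F _ _ _)

/-- Monotonicity in the integrand. -/
theorem treeExpE2_mono (F : Finset K) (e₁ e₂ : K → Bool) : ∀ (T : STree K) {φ ψ : K → Bool → Bool → K},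
    (∀ v b b', φ v b b' ≤ ψ v b b') → treeExpE2 F e₁ e₂ T φ ≤ treeExpE2 F e₁ e₂ T ψ
  | .leaf x, _, _, h => h x false false
  | .node l r, _, _, h =>
      treeExpE2_mono F e₁ e₂ l (fun _ _ _ => treeExpE2_mono F e₁ e₂ r (fun _ _ _ =>
        step_mono F _ (fun _ => h _ _ _)))

omit [IsStrictOrderedRing K] in
/-- First marginal. -/
theorem treeExpE2_fst (F : Finset K) (e₁ e₂ : K → Bool) : ∀ (T : STree K) (φ : K → Bool → K),
    treeExpE2 F e₁ e₂ T (fun v b _ => φ v b) = treeExpE F e₁ T φ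
  | .leaf x, φ => rfl
  | .node l r, φ => by
      simp only [treeExpE2, treeExpE]
      rw [← treeExpE2_fst F e₁ e₂ l]
      refine treeExpE2_congr F e₁ e₂ l (fun a fa ga => ?_)
      rw [← treeExpE2_fst F e₁ e₂ r]

omit [IsStrictOrderedRing K] in
/-- Second marginal. -/
theorem treeExpE2_snd (F : Finset K) (e₁ e₂ : K → Bool) : ∀ (T : STree K) (φ : K → Bool → K),
    treeExpE2 F e₁ e₂ T (fun v _ b' => φ v b') = treeExpE F e₂ T φ
  | .leaf x, φ => rfl
  | .node l r, φ => by
      simp only [treeExpE2, treeExpE]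
      rw [← treeExpE2_snd F e₁ e₂ l]
      refine treeExpE2_congr F e₁ e₂ l (fun a fa ga => ?_)
      rw [← treeExpE2_snd F e₁ e₂ r]

omit [IsStrictOrderedRing K] in
/-- The disjunction of two exit predicates factors through the two-flag semantics. -/
theorem treeExpE_or (F : Finset K) (e₁ e₂ : K → Bool) : ∀ (T : STree K) (φ : K → Bool → K),
    treeExpE F (fun c => e₁ c || e₂ c) T φ = treeExpE2 F e₁ e₂ T (fun v b b' => φ v (b || b'))
  | .leaf x, φ => rfl
  | .node l r, φ => by
      simp only [treeExpE2, treeExpE]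
      rw [treeExpE_or F e₁ e₂ l]
      refine treeExpE2_congr F e₁ e₂ l (fun a fa ga => ?_)
      rw [treeExpE_or F e₁ e₂ r]
      refine treeExpE2_congr F e₁ e₂ r (fun b fb gb => ?_)
      refine congrArg (step F (a + b)) (funext fun v => congrArg (φ v) ?_)
      cases fa <;> cases fb <;> cases ga <;> cases gb <;> cases e₁ (a + b) <;> cases e₂ (a + b) <;> rfl

/-- **Union bound**: `P(some node satisfies e₁ ∨ e₂) ≤ P(some node satisfies e₁) + P(… e₂)`. -/
theorem exitE_union (F : Finset K) (e₁ e₂ : K → Bool) (T : STree K) :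
    exitE F (fun c => e₁ c || e₂ c) T ≤ exitE F e₁ T + exitE F e₂ T := by
  unfold exitE
  rw [treeExpE_or, ← treeExpE2_fst F e₁ e₂ T, ← treeExpE2_snd F e₁ e₂ T, ← treeExpE2_add]
  refine treeExpE2_mono F e₁ e₂ T (fun v b b' => ?_)
  cases b <;> cases b' <;> norm_num

/-! ### Saturation as an exit predicate -/

omit [Field K] [IsStrictOrderedRing K] in
/-- The hull of a format with least element `lo` and greatest element `hi` is `[lo, hi]`. -/
theorem inHull_iff_bounds {F : Finset K} {lo hi : K} (hlo : lo ∈ F) (hhi : hi ∈ F)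
    (hb : ∀ y ∈ F, lo ≤ y ∧ y ≤ hi) (c : K) : InHull F c ↔ lo ≤ c ∧ c ≤ hi := by
  constructor
  · rintro ⟨⟨y, hy, hyc⟩, ⟨z, hz, hcz⟩⟩
    exact ⟨(hb y hy).1.trans hyc, hcz.trans (hb z hz).2⟩
  · rintro ⟨h1, h2⟩
    exact ⟨⟨lo, hlo, h1⟩, ⟨hi, hhi, h2⟩⟩

omit [IsStrictOrderedRing K] in
/-- **Saturation is the exit predicate `c < lo ∨ hi < c`.** -/
theorem satProbT_eq_exitE {F : Finset K} {lo hi : K} (hlo : lo ∈ F) (hhi : hi ∈ F)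
    (hb : ∀ y ∈ F, lo ≤ y ∧ y ≤ hi) (T : STree K) :
    satProbT F T = exitE F (fun c => decide (c < lo) || decide (hi < c)) T := by
  unfold satProbT exitProb exitE
  rw [treeExpF_eq_treeExpE]
  have hO : outB F = (fun c => decide (c < lo) || decide (hi < c)) := by
    funext c
    rw [Bool.eq_iff_iff]
    simp only [outB_eq_true_iff, inHull_iff_bounds hlo hhi hb, Bool.or_eq_true, decide_eq_true_eq,
      not_and_or, not_le]
  rw [hO]

/-- **THE BOX CERTIFICATE.** If `Tlo ≤ T ≤ Thi` leafwise then
`P(sat, T) ≤ P(upper exit, Thi) + P(lower exit, Tlo)`. -/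
theorem satProbT_le_corners {F : Finset K} {lo hi : K} (hlo : lo ∈ F) (hhi : hi ∈ F)
    (hb : ∀ y ∈ F, lo ≤ y ∧ y ≤ hi) {Tlo T Thi : STree K} (h₁ : LeafLE Tlo T) (h₂ : LeafLE T Thi) :
    satProbT F T ≤ exitE F (fun c => decide (hi < c)) Thi + exitE F (fun c => decide (c < lo)) Tlo := by
  have hF : F.Nonempty := ⟨lo, hlo⟩
  rw [satProbT_eq_exitE hlo hhi hb]
  calc exitE F (fun c => decide (c < lo) || decide (hi < c)) T
      ≤ exitE F (fun c => decide (c < lo)) T + exitE F (fun c => decide (hi < c)) T := exitE_union F _ _ T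
    _ ≤ exitE F (fun c => decide (c < lo)) Tlo + exitE F (fun c => decide (hi < c)) Thi :=
        add_le_add (exitE_anti_leaves hF lo h₁) (exitE_mono_leaves hF hi h₂)
    _ = _ := add_comm _ _

omit [IsStrictOrderedRing K] in
/-- A tree of zeros never exits downward past `lo ≤ 0`. -/
theorem exitE_lower_zero {F : Finset K} (h0 : (0 : K) ∈ F) {lo : K} (hlo0 : lo ≤ 0) (T : STree K) :
    exitE F (fun c => decide (c < lo)) (T.map fun _ => (0 : K)) = 0 := by
  unfold exitE
  rw [treeExpE_zero h0 (by simpa using hlo0) T]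
  simp

/-- **Nonnegative data: one corner suffices.** If `0 ≤ T ≤ Thi` leafwise, `0 ∈ F` and `lo ≤ 0` then
`P(sat, T) ≤ P(upper exit, Thi)`. -/
theorem satProbT_le_upper_corner {F : Finset K} {lo hi : K} (hlo : lo ∈ F) (hhi : hi ∈ F)
    (hb : ∀ y ∈ F, lo ≤ y ∧ y ≤ hi) (h0 : (0 : K) ∈ F) (hlo0 : lo ≤ 0) {T Thi : STree K}
    (h₁ : LeafLE (T.map fun _ => (0 : K)) T) (h₂ : LeafLE T Thi) :
    satProbT F T ≤ exitE F (fun c => decide (hi < c)) Thi := by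
  have h := satProbT_le_corners hlo hhi hb h₁ h₂
  rwa [exitE_lower_zero h0 hlo0, add_zero] at h

/-- The upper-exit probability is itself a lower bound for `P(sat)` at the corner: the box
certificate is ATTAINED there. -/
theorem exitE_upper_le_satProbT {F : Finset K} {lo hi : K} (hlo : lo ∈ F) (hhi : hi ∈ F)
    (hb : ∀ y ∈ F, lo ≤ y ∧ y ≤ hi) (T : STree K) :
    exitE F (fun c => decide (hi < c)) T ≤ satProbT F T := by
  rw [satProbT_eq_exitE hlo hhi hb, exitE, exitE, treeExpE_or, ← treeExpE2_snd F (fun c => decide (c < lo))]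
  refine treeExpE2_mono F _ _ T (fun v b b' => ?_)
  cases b <;> cases b' <;> norm_num

/-! ### Hull data of the format literals -/

/-- Hull facts `−maxRat ∈ F`, `maxRat ∈ F`, `F ⊆ [−maxRat, maxRat]` for a `MiniFloat` value set. -/
theorem valueSet_bounds (φ : Format) :
    (-φ.maxRat) ∈ MiniFloat.valueSet φ ∧ φ.maxRat ∈ MiniFloat.valueSet φ ∧
      ∀ y ∈ MiniFloat.valueSet φ, -φ.maxRat ≤ y ∧ y ≤ φ.maxRat := by
  refine ⟨MiniFloat.neg_maxRat_mem_valueSet φ, MiniFloat.maxRat_mem_valueSet φ, fun y hy => ?_⟩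
  obtain ⟨y', rfl⟩ := MiniFloat.mem_valueSet.mp hy
  exact abs_le.mp (MiniFloat.abs_toRat_le_maxRat y')

omit [Field K] [IsStrictOrderedRing K] in
/-- Leafwise comparison of two left combs. -/
theorem leafLE_comb {x y : ℕ → K} {s t : K} (hs : s ≤ t) (h : ∀ i, x i ≤ y i) :
    ∀ n, LeafLE (comb x s n) (comb y t n)
  | 0 => hs
  | n + 1 => ⟨leafLE_comb hs h n, h n⟩

omit [Field K] [LinearOrder K] [IsStrictOrderedRing K] in
/-- Mapping the leaves of a left comb. -/
theorem map_comb {L : Type*} (f : K → L) (x : ℕ → K) (s : K) :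
    ∀ n, (comb x s n).map f = comb (fun i => f (x i)) (f s) n
  | 0 => rfl
  | n + 1 => by simp only [comb, STree.map, map_comb f x s n]

/-! ### Kernel instance: E2M1, eight summands in `[0, 1]` -/

namespace Box

/-- Corner law (2⁷ branches, plain kernel enumeration): the E2M1 left comb of eight `1`s exits
upward (`some partial sum + 1 > 6`) with probability exactly `7/8` — equal to its saturation
probability. -/
theorem e2m1_comb8_corner :
    exitE FP4.e2m1 (fun c => decide (6 < c)) (comb (fun _ => (1 : ℚ)) 1 7) = 7 / 8 ∧
      satProbT FP4.e2m1 (comb (fun _ => (1 : ℚ)) 1 7) = 7 / 8 := by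
  decide +kernel

/-- Hull facts of the E2M1 literal. -/
theorem e2m1_hull : (-6 : ℚ) ∈ FP4.e2m1 ∧ (6 : ℚ) ∈ FP4.e2m1 ∧ (0 : ℚ) ∈ FP4.e2m1 ∧
    ∀ y ∈ FP4.e2m1, (-6 : ℚ) ≤ y ∧ y ≤ 6 := by
  decide +kernel

/-- **Box certificate, E2M1**: every left-comb (recursive) SR sum `((s + x₀) + x₁) + ⋯ + x₆` of eight
rationals in `[0, 1]` (not necessarily representable) saturates with probability at most `7/8`;
the bound is attained at `s = xᵢ = 1`. No enumeration over the data. -/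
theorem e2m1_comb8_box (x : ℕ → ℚ) (s : ℚ) (hs : 0 ≤ s ∧ s ≤ 1) (hx : ∀ i, 0 ≤ x i ∧ x i ≤ 1) :
    satProbT FP4.e2m1 (comb x s 7) ≤ 7 / 8 := by
  obtain ⟨hlo, hhi, h0, hb⟩ := e2m1_hull
  have h₁ : LeafLE ((comb x s 7).map fun _ => (0 : ℚ)) (comb x s 7) := by
    rw [map_comb]; exact leafLE_comb hs.1 (fun i => (hx i).1) 7
  have h₂ : LeafLE (comb x s 7) (comb (fun _ => (1 : ℚ)) 1 7) := leafLE_comb hs.2 (fun i => (hx i).2) 7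
  exact (satProbT_le_upper_corner hlo hhi hb h0 (by norm_num) h₁ h₂).trans e2m1_comb8_corner.1.le

end Box

end Summit.Ventures.CertifiedArithmetic.LowPrec.SR
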